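import Summits.CriticalPhenomena.PercolationContinuityZ3.Theorems.PercNearOneGluingNoHeavyLowerTailStarSetForestCertificateTools
import HarnessLib

/-!
# `NoHeavyLowerTail` (stmt-CriticalPhenomena-4575) — the configuration expansion of the supply inequality (Lemma 0 of U1-PROOF.md)

Support file (prover `prim-gen-swap` gen 11; `--supports stmt-CriticalPhenomena-4575`).  No definitions, no named facts, no sorries.

For classes `ι` (linearly ordered = the leaf-peeling order), weights `θ`, an adjacency relation, counted chords `Cr`, forest classes `F` and
child edges `Ch`, the exact identity behind `StarSet.supply_second_order_reduction(_surplus)`: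
`Σ_S W(S)·(n(S) − y(S)) = Σ_{κ∈Cr} θ_κ Π_{far(κ)}(1−θ) − (Π_F (1−θ) + Σ_{a∈Ch} θ_a Π_{F<a}(1−θ))`,
where `W(S) = Π_Sθ·Π_{∉S}(1−θ)`, `n(S)` = number of chords of `Cr` in `S` all of whose non-neighbours are closed, and
`y(S)` = [no class of `F` is open] + Σ_{a∈Ch}[a is open and every `F`-class before `a` is closed].
This is equation (★) of U1-PROOF.md ("Lemma 0"); the charging scheme of that memo bounds the left-hand side configuration by configuration.

* `StarSet.config_expansion_identity`.
-/

namespace Summit.CriticalPhenomena.PercolationContinuityZ3.Theorems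

open Finset
open scoped BigOperators

namespace StarSet

variable {ι : Type*} [Fintype ι] [LinearOrder ι]

/-- **Configuration expansion (Lemma 0 of U1-PROOF.md).**  See the file header. -/
theorem config_expansion_identity (θ : ι → ℝ) (adj : ι → ι → Prop) [DecidableRel adj] (Cr F Ch : Finset ι)
    (hrefl : ∀ κ ∈ Cr, adj κ κ) :
    ∑ S ∈ (univ : Finset ι).powerset, ((∏ k ∈ S, θ k) * ∏ k ∈ univ \ S, (1 - θ k)) *
        ((∑ κ ∈ Cr, (if (κ ∈ S ∧ ∀ j ∈ univ.filter (fun j => ¬ adj j κ), j ∉ S) then (1 : ℝ) else 0)) -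
          ((if (∀ I ∈ F, I ∉ S) then (1 : ℝ) else 0) +
            ∑ a ∈ Ch, (if (a ∈ S ∧ ∀ b ∈ F.filter (· < a), b ∉ S) then (1 : ℝ) else 0))) =
      ∑ κ ∈ Cr, θ κ * ∏ j ∈ univ.filter (fun j => ¬ adj j κ), (1 - θ j) -
        (∏ I ∈ F, (1 - θ I) + ∑ a ∈ Ch, θ a * ∏ b ∈ F.filter (· < a), (1 - θ b)) := by
  classical
  set W : Finset ι → ℝ := fun S => (∏ k ∈ S, θ k) * ∏ k ∈ univ \ S, (1 - θ k) with hW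
  set PS := (univ : Finset ι).powerset with hPS
  set far : ι → Finset ι := fun κ => univ.filter (fun j => ¬ adj j κ) with hfar
  have hκfar : ∀ κ ∈ Cr, κ ∉ far κ := fun κ hκ h => (mem_filter.1 h).2 (hrefl κ hκ)
  -- split the sum
  have hlin : ∀ S ∈ PS, W S * ((∑ κ ∈ Cr, (if (κ ∈ S ∧ ∀ j ∈ far κ, j ∉ S) then (1 : ℝ) else 0)) -
      ((if (∀ I ∈ F, I ∉ S) then (1 : ℝ) else 0) + ∑ a ∈ Ch, (if (a ∈ S ∧ ∀ b ∈ F.filter (· < a), b ∉ S) then (1 : ℝ) else 0))) =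
      (∑ κ ∈ Cr, W S * (if (κ ∈ S ∧ ∀ j ∈ far κ, j ∉ S) then (1 : ℝ) else 0)) -
      (W S * (if (∀ I ∈ F, I ∉ S) then (1 : ℝ) else 0) +
        ∑ a ∈ Ch, W S * (if (a ∈ S ∧ ∀ b ∈ F.filter (· < a), b ∉ S) then (1 : ℝ) else 0)) := by
    intro S _; rw [mul_sub, mul_add, mul_sum, mul_sum]
  rw [sum_congr rfl hlin, sum_sub_distrib, sum_add_distrib, sum_comm, sum_comm (s := PS) (t := Ch)]
  -- evaluate the three cylinder sums
  have hL : ∀ κ ∈ Cr, ∑ S ∈ PS, W S * (if (κ ∈ S ∧ ∀ j ∈ far κ, j ∉ S) then (1 : ℝ) else 0) =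
      θ κ * ∏ j ∈ far κ, (1 - θ j) := fun κ hκ => cylinder_sum_one_open θ κ (far κ) (hκfar κ hκ)
  have h0 : ∑ S ∈ PS, W S * (if (∀ I ∈ F, I ∉ S) then (1 : ℝ) else 0) = ∏ I ∈ F, (1 - θ I) := cylinder_sum_closed θ F
  have hA : ∀ a ∈ Ch, ∑ S ∈ PS, W S * (if (a ∈ S ∧ ∀ b ∈ F.filter (· < a), b ∉ S) then (1 : ℝ) else 0) =
      θ a * ∏ b ∈ F.filter (· < a), (1 - θ b) := fun a _ => cylinder_sum_one_open θ a (F.filter (· < a)) (by simp)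
  rw [sum_congr rfl hL, h0, sum_congr rfl hA]

end StarSet

end Summit.CriticalPhenomena.PercolationContinuityZ3.Theorems
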